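import Summits.Ventures.HSemireg.WedgeHankelNodeImagesLowTop

/-!
# Venture HSemireg — DIVISOR TORELLI ON P¹ IN EVERY DEGREE: the node kernels of a divisor on `P¹` of total order `≤ k` see neither the point at `∞` (if it is not a node) nor a higher
# order at `∞` — the order at `∞` is read off the intersection (G8 §108's finite Torelli completed on P¹)

HONEST FRAMING. Part of the Lean index of the computation cell `pub-hsemireg` (seat p10 gen 17, Sunday typer «UNIFORM-IN-n»).
Finite-dimensional EXTERIOR ALGEBRA over a field ONLY: no variety, no cohomology theory, no sheaf, no Ext group, no semiregularity map;
nothing here says that HC / HC_CM / HC_AV holds; no Literature fact is declared or used.  Custodian versions as in `WedgeHankelSiegelIdeal` (1/3) and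
`WedgeKernelDuality`; the dictionary (the node at `∞` of order `P∞ + 1` ↦ `w_n(rev_n q∞)`) is QUOTED, never asserted.

WHAT IS IN THE TREE.  G8 `iInf_Kr_w_expMul_not_le_Kr_w_exp` / `…_not_le_succ` / `range_eq…` / `order_eq…` (finite divisors), G10 `finrank_iInf_Kr_inf_Kr_rev_add` (the P¹ count in every degree),
G8 `finrank_iInf_Kr_w_expMul_add` (the finite count).  THIS FILE (namespace `Summit.Ventures.HSemireg.Wedge.KernelDuality` continued; imports G10):
* §118 **`iInf_Kr_w_expMul_not_le_Kr_w_rev`**: a finite divisor of total order `≤ k` (distinct nodes, `k + P_i ≤ n`) does not see a node at `∞`: `⋂_i Kr(node i, k) ⊄ Kr(univ, w_n(rev_n q∞), k)`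
  for ANY `q∞` of exact order `P∞` with `k + P∞ ≤ n` (adding `∞` with order `1` already costs `C(n,k)` dimensions, G10's count).
* §119 **`iInf_Kr_inf_Kr_rev_not_le_rev_succ`**: a divisor on `P¹` of total order `≤ k` does not see a higher order at `∞`; hence **`orderTop_eq_of_iInf_Kr_inf_Kr_rev_eq`**: two such divisors with
  the same finite node data and the same intersection in degree `k` have the same order at `∞` (`P∞ = P∞′`).
NOT typed here: the full P¹ statement with different finite parts (combine with G8 §108 verbatim); anything Ext-side.  Class side only; new names only.
-/

open Module

namespace Summit.Ventures.HSemireg.Wedge.KernelDuality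

open Summit.Ventures.HSemireg.Wedge Summit.Ventures.HSemireg.Wedge.Kunneth Summit.Ventures.HSemireg.Wedge.Hankel
  Summit.Ventures.HSemireg.Wedge.HankelSiegel Summit.Ventures.HSemireg.Wedge.HankelSiegelIdeal Summit.Ventures.HSemireg.Wedge.KunnethKernel
  Summit.Ventures.HSemireg.Wedge.HankelSecant Summit.Ventures.HSemireg.Wedge.HankelFrameChange Summit.Ventures.HSemireg.Wedge.HankelPureKernel

variable (K : Type*) [Field K] {n : ℕ}

/-! ## §118. A finite divisor of total order `≤ k` does not see the node at `∞` -/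

/-- the order-`(P∞+1)` kernel at `∞` lies in the kernel of every lower-order class at `∞` (E4's names; `k + P∞ ≤ n`). -/
lemma Kr_w_rev_le_of_order_le {k P t : ℕ} (htP : t ≤ P) (hkP : k + P ≤ n) {q s : ℕ → K} (hq : ∀ j, P < j → q j = 0) (hqP : q P ≠ 0)
    (hs : ∀ j, t < j → s j = 0) (hst : s t ≠ 0) :
    Kr K Finset.univ (w K n n (rev K n q)) k ≤ Kr K Finset.univ (w K n n (rev K n s)) k := by
  rw [HankelFrameChange.Kr_w_rev_of_order K hkP hq hqP, HankelFrameChange.Kr_w_rev_of_order K (by omega) hs hst]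
  exact sup_le_sup_left (yRich_anti K htP) _

/-- **A FINITE DIVISOR OF TOTAL ORDER `≤ k` DOES NOT SEE A NODE AT `∞`: `⋂_i Kr(univ, w_n(expMul λ_i q_i), k) ⊄ Kr(univ, w_n(rev_n q∞), k)`** for any `q∞` of exact order `P∞` (`k + P∞ ≤ n`),
distinct `λ_i`, exact orders with `k + P_i ≤ n`, `Σ_i (P_i+1) ≤ k` — adding the point at `∞` with order `1` costs `C(n,k) > 0` dimensions (G10's count vs G8's count). -/
theorem iInf_Kr_w_expMul_not_le_Kr_w_rev {k r : ℕ} {lam : Fin r → K} (hlam : Function.Injective lam) {P : Fin r → ℕ} {q : Fin r → ℕ → K}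
    (hq : ∀ i j, P i < j → q i j = 0) (hqP : ∀ i, q i (P i) ≠ 0) (hkP : ∀ i, k + P i ≤ n) (hD : ∑ i, (P i + 1) ≤ k) (hr : 0 < r)
    {Pinf : ℕ} {qinf : ℕ → K} (hqi : ∀ j, Pinf < j → qinf j = 0) (hqiP : qinf Pinf ≠ 0) (hkPinf : k + Pinf ≤ n) :
    ¬ (⨅ i, Kr K Finset.univ (w K n n (expMul K (lam i) (q i))) k) ≤ Kr K Finset.univ (w K n n (rev K n qinf)) k := by
  intro hle
  have hk : k ≤ n := by omega
  -- the point at ∞ of order 1 (q∞ = δ_0): its kernel contains the order-(P∞+1) kernel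
  have hle' : (⨅ i, Kr K Finset.univ (w K n n (expMul K (lam i) (q i))) k) ≤ Kr K Finset.univ (w K n n (rev K n (fun j => if j = 0 then (1 : K) else 0))) k :=
    hle.trans (Kr_w_rev_le_of_order_le K (Nat.zero_le _) hkPinf hqi hqiP (fun j hj => if_neg (by omega)) (by rw [if_pos rfl]; exact one_ne_zero))
  have h1 := finrank_iInf_Kr_inf_Kr_rev_add K hlam hq hqP hkP (Pinf := 0) (qinf := fun j => if j = 0 then (1 : K) else 0) (fun j hj => if_neg (by omega))
    (by rw [if_pos rfl]; exact one_ne_zero) (by omega) (by omega) hr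
  have h2 := finrank_iInf_Kr_w_expMul_add K hlam hq hqP hkP (by omega) hr
  rw [inf_eq_left.mpr hle'] at h1
  have hpos : 0 < n.choose k := Nat.choose_pos hk
  have : (∑ i, (P i + 1) + (0 + 1)) * n.choose k = (∑ i, (P i + 1)) * n.choose k + n.choose k := by ring
  omega

/-! ## §119. A divisor on `P¹` of total order `≤ k` does not see a higher order at `∞` -/

/-- **`(⋂_i Kr(node i, k)) ⊓ Kr(univ, w_n(rev_n q∞), k) ⊄ Kr(univ, w_n(rev_n δ_{P∞+1}), k)`**: a divisor on `P¹` of total order `Σ_i (P_i+1) + (P∞+1) ≤ k` (distinct finite nodes, `k + P_i ≤ n`,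
`k + P∞ + 1 ≤ n`) does not see the order `P∞ + 2` at `∞` (raising the order costs `C(n,k)`, G10's count twice). -/
theorem iInf_Kr_inf_Kr_rev_not_le_rev_succ {k r : ℕ} {lam : Fin r → K} (hlam : Function.Injective lam) {P : Fin r → ℕ} {q : Fin r → ℕ → K}
    (hq : ∀ i j, P i < j → q i j = 0) (hqP : ∀ i, q i (P i) ≠ 0) (hkP : ∀ i, k + P i ≤ n) (hr : 0 < r) {Pinf : ℕ} {qinf : ℕ → K}
    (hqi : ∀ j, Pinf < j → qinf j = 0) (hqiP : qinf Pinf ≠ 0) (hkPinf : k + Pinf + 1 ≤ n) (hD : ∑ i, (P i + 1) + (Pinf + 1) ≤ k) :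
    ¬ (⨅ i, Kr K Finset.univ (w K n n (expMul K (lam i) (q i))) k) ⊓ Kr K Finset.univ (w K n n (rev K n qinf)) k ≤
        Kr K Finset.univ (w K n n (rev K n (fun j => if j = Pinf + 1 then (1 : K) else 0))) k := by
  intro hle
  have hk : k ≤ n := by omega
  have h1 := finrank_iInf_Kr_inf_Kr_rev_add K hlam hq hqP hkP (Pinf := Pinf + 1) (qinf := fun j => if j = Pinf + 1 then (1 : K) else 0)
    (fun j hj => if_neg (by omega)) (by rw [if_pos rfl]; exact one_ne_zero) hkPinf (by omega) hr
  have h2 := finrank_iInf_Kr_inf_Kr_rev_add K hlam hq hqP hkP hqi hqiP (by omega) (by omega) hr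
  -- under `hle` the raised intersection equals the old one
  have e : (⨅ i, Kr K Finset.univ (w K n n (expMul K (lam i) (q i))) k) ⊓ Kr K Finset.univ (w K n n (rev K n (fun j => if j = Pinf + 1 then (1 : K) else 0))) k =
      (⨅ i, Kr K Finset.univ (w K n n (expMul K (lam i) (q i))) k) ⊓ Kr K Finset.univ (w K n n (rev K n qinf)) k := by
    refine le_antisymm (le_inf inf_le_left (inf_le_right.trans ?_)) (le_inf inf_le_left hle)
    exact Kr_w_rev_le_of_order_le K (Nat.le_succ Pinf) hkPinf (fun j hj => if_neg (by omega)) (by rw [if_pos rfl]; exact one_ne_zero) hqi hqiP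
  rw [e] at h1
  have hpos : 0 < n.choose k := Nat.choose_pos hk
  have : (∑ i, (P i + 1) + (Pinf + 1 + 1)) * n.choose k = (∑ i, (P i + 1) + (Pinf + 1)) * n.choose k + n.choose k := by ring
  omega

/-- **THE ORDER AT `∞` IS READ OFF THE INTERSECTION**: two divisors on `P¹` with the same finite node data (distinct nodes, `k + P_i ≤ n`), nodes at `∞` of exact orders `P∞`, `P∞′` (`k + P∞ ≤ n`,
`k + P∞′ ≤ n`), both of total order `≤ k`, and the SAME intersection of node kernels in degree `k` have `P∞ = P∞′`. -/
theorem orderTop_eq_of_iInf_Kr_inf_Kr_rev_eq {k r : ℕ} {lam : Fin r → K} (hlam : Function.Injective lam) {P : Fin r → ℕ} {q : Fin r → ℕ → K}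
    (hq : ∀ i j, P i < j → q i j = 0) (hqP : ∀ i, q i (P i) ≠ 0) (hkP : ∀ i, k + P i ≤ n) (hr : 0 < r) {Pinf Pinf' : ℕ} {qinf qinf' : ℕ → K}
    (hqi : ∀ j, Pinf < j → qinf j = 0) (hqiP : qinf Pinf ≠ 0) (hkPinf : k + Pinf ≤ n) (hD : ∑ i, (P i + 1) + (Pinf + 1) ≤ k)
    (hqi' : ∀ j, Pinf' < j → qinf' j = 0) (hqiP' : qinf' Pinf' ≠ 0) (hkPinf' : k + Pinf' ≤ n) (hD' : ∑ i, (P i + 1) + (Pinf' + 1) ≤ k)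
    (heq : (⨅ i, Kr K Finset.univ (w K n n (expMul K (lam i) (q i))) k) ⊓ Kr K Finset.univ (w K n n (rev K n qinf)) k =
      (⨅ i, Kr K Finset.univ (w K n n (expMul K (lam i) (q i))) k) ⊓ Kr K Finset.univ (w K n n (rev K n qinf')) k) : Pinf = Pinf' := by
  by_contra hne
  rcases Nat.lt_or_gt_of_ne hne with hlt | hlt
  · refine iInf_Kr_inf_Kr_rev_not_le_rev_succ K hlam hq hqP hkP hr hqi hqiP (by omega) hD ?_
    rw [heq]
    exact inf_le_right.trans (Kr_w_rev_le_of_order_le K (P := Pinf') (t := Pinf + 1) (by omega) hkPinf' hqi' hqiP' (fun j hj => if_neg (by omega))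
      (by rw [if_pos rfl]; exact one_ne_zero))
  · refine iInf_Kr_inf_Kr_rev_not_le_rev_succ K hlam hq hqP hkP hr hqi' hqiP' (by omega) hD' ?_
    rw [← heq]
    exact inf_le_right.trans (Kr_w_rev_le_of_order_le K (P := Pinf) (t := Pinf' + 1) (by omega) hkPinf hqi hqiP (fun j hj => if_neg (by omega))
      (by rw [if_pos rfl]; exact one_ne_zero))

end Summit.Ventures.HSemireg.Wedge.KernelDuality
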